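import Summits.HodgeConjecture.HodgeConjecture.Theorems.R90S4AdmissibleProductSplitsBoxChar   -- ★ (F1) `exists_eq_boxChar_of_isAdmissible` (hand p04, p861511)
import Summits.HodgeConjecture.HodgeConjecture.Theorems.R90S4SimilOrbitCardLeTwo            -- ★ (F2c) `exists_finset_similOrbit_card_le_two` (hand p04, p861607)
import Literature.NumberTheory.Automorphic.LocalUnitaryIntegralLevel                          -- ★ `isCompact_isOpen_cmLocalIntegralLevel` (compact open `U(H)(𝒪_v)`)
import HarnessLib

/-!
# R90-TF · S4 (Ch. 13.1–2) · hand p04 — SOCKET S4#B3 `stub_R90_S4_H_cover` PAID (NAME-SHAPE): every ADMISSIBLE irreducible class of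
# `H_v = U(Φ₂)(L⁺_v) × U(Φ₁)(L⁺_v)` lies in an L-packet of `H_v` (Rogawski §12.1–12.2: `ρ = ρ₁ ⊗ χ`; a packet is `O ⊠ χ`, `O` a `PGL₂(F)`-orbit)

Cell `hodgecm-mathlib`, crux H413 (`stmt-HodgeConjecture-24833`), route of record `HCCMUnconditional`; programme R90-TF (brief
`director/R90-BRIEF.v2.md` 1f40d54518340a35), section S4 = Rogawski Ch. 13.1–2 (base `R90-C131`), seat R90-C131-p04 (g0), socket S4#B3
`Summit.HodgeConjecture.HodgeConjecture.R90.S4.stub_R90_S4_H_cover` (`Cruxes/H413/Lines/R90_S4_HPacketsU2B.lean` :338, ED. 1, tree sha16 251612dbcc286c69)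
ROAD «SCHUR ⊠-SPLITTING + FINITE ORBIT» (DEAL-S4-WAVE1, K2E2-plan (g6)).  Lane `--supports stmt-HodgeConjecture-24833 --as helper`; ONE public theorem,
no definition, no instance, no notation, no `sorry`.

NAME-SHAPE.  `Theorems/` may not import `Cruxes/…`, so the statement below is the socket's type with file B's definitions `HLoc`, `U2Loc`, `U1Loc`,
`Φ₂Loc` (abbreviations) and `IsRogPacketH`, `IsRogPacketU2`, `IsU2SimilConj` (plain `def`s, bodies copied token for token) UNFOLDED; in a probe importing both,
`theorem probe : <type of stub_R90_S4_H_cover> := stub_R90_S4_H_cover_proof` elaborates by `exact` (δ-unfolding) — certified at HOME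
(`R90/R90-C131-p04/g0/probe_cover.lean`, rc 0).

THE MATHEMATICS ([Rogawski1990, §12.1 pp. 171–172, §12.2 p. 173, Prop. 11.1.1 (a) p. 161]; [BushnellHenniart2006, §2.6 Cor. 1]).  Let `τ` be an admissible
irreducible class of `H_v = U(Φ₂)_v × U(Φ₁)_v`.  (F1) `U(Φ₁)_v ≤ GL₁` is commutative and both factors have compact open subgroups (★
`isCompact_isOpen_cmLocalIntegralLevel`), so by Schur `τ = σ₀ ⊠ χ` with `σ₀ ∈ Irr(U(Φ₂)_v)` admissible and `χ` a smooth character of `U(Φ₁)_v` (★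
`exists_eq_boxChar_of_isAdmissible`).  (F2c) The similitude (`PGL₂(F)`-) orbit of `σ₀` is a finset `O` (★ `exists_finset_similOrbit_card_le_two`; even
`#O ≤ 2`), so `O` is an L-packet of `U(Φ₂)_v` generated by the admissible `σ₀`, `S := O ⊠ χ` is an L-packet of `H_v`, and `τ = σ₀ ⊠ χ ∈ S` because
`σ₀ ∈ O` (`T = 1` is a similitude and `Ad(1)` fixes the class, ★ `IrrClass.comap_eq_self_of_forall_eq_conj`).

HONEST LABEL: HC_CM is proved only modulo the 7 printed citations (2 remaining named inputs: hLiu418 = stmt-HodgeConjecture-24832, h413 =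
stmt-HodgeConjecture-24833) until rung 0 closes; this file pays ONE S4 socket of the R90-TF statement layer and discharges no citation by itself.
REL ≠ ★ ≠ BUILT.

## References
* [Rogawski1990] J. D. Rogawski, *Automorphic Representations of Unitary Groups in Three Variables*, Ann. of Math. Stud. 123 (1990), §11.1 p. 161 and
  Prop. 11.1.1 (a); §12.1 pp. 171–172; §12.2 p. 173.
* [BushnellHenniart2006] C. J. Bushnell, G. Henniart, *The Local Langlands Conjecture for GL(2)*, Grundlehren 335 (2006), §2.6 Corollary 1, §9.1.
* [PlatonovRapinchuk1994] V. Platonov, A. Rapinchuk, *Algebraic Groups and Number Theory* (1994), §2.3, §5.1.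
-/

set_option autoImplicit false
set_option linter.dupNamespace false

noncomputable section

open NumberField IsDedekindDomain
open scoped Matrix MatrixGroups
open Literature.NumberTheory.Automorphic Literature.NumberTheory.Automorphic.UnitaryGroup

namespace Summit.HodgeConjecture.HodgeConjecture.R90.S4

/-- **SOCKET S4#B3 `stub_R90_S4_H_cover`, NAME-SHAPE — every admissible irreducible class of `H_v = U(Φ₂)(L⁺_v) × U(Φ₁)(L⁺_v)` lies in an
L-packet of `H_v`** (the type of `R90.S4.stub_R90_S4_H_cover` with `HLoc`, `U2Loc`, `U1Loc`, `Φ₂Loc`, `IsRogPacketH`, `IsRogPacketU2`, `IsU2SimilConj`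
unfolded): `τ = σ₀ ⊠ χ` by (F1) Schur ⊠-splitting (★ `exists_eq_boxChar_of_isAdmissible`; `U(Φ₁)_v` commutative, compact open levels ★
`isCompact_isOpen_cmLocalIntegralLevel`), the similitude orbit `O ∋ σ₀` of `σ₀` is a finset (★ (F2c) `exists_finset_similOrbit_card_le_two`), and
`S := O ⊠ χ ∋ τ`. [cite: Rogawski1990, §12.1 pp. 171–172; §12.2 p. 173; Prop. 11.1.1 (a) p. 161] [cite: BushnellHenniart2006, §2.6 Corollary 1] -/
theorem stub_R90_S4_H_cover_proof :
    ∀ (L : Type) [Field L] [NumberField L] [IsCMField L] (v : HeightOneSpectrum (𝓞 ↥(maximalRealSubfield L)))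
      (τ : IrrClass ((cmDatum L 2 (Matrix.of fun i j : Fin 2 => if i.val + j.val + 1 = 2 then (1 : L) else 0)).Local v ×
        (cmDatum L 1 (Matrix.of fun i j : Fin 1 => if i.val + j.val + 1 = 1 then (1 : L) else 0)).Local v)),
      τ.IsAdmissible →
        ∃ S : Finset (IrrClass ((cmDatum L 2 (Matrix.of fun i j : Fin 2 => if i.val + j.val + 1 = 2 then (1 : L) else 0)).Local v ×
          (cmDatum L 1 (Matrix.of fun i j : Fin 1 => if i.val + j.val + 1 = 1 then (1 : L) else 0)).Local v)),
          (∃ (O : Finset (IrrClass ((cmDatum L 2 (Matrix.of fun i j : Fin 2 => if i.val + j.val + 1 = 2 then (1 : L) else 0)).Local v)))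
              (χ : (cmDatum L 1 (Matrix.of fun i j : Fin 1 => if i.val + j.val + 1 = 1 then (1 : L) else 0)).Local v →* ℂˣ)
              (hχ : IsOpen ((χ.ker : Subgroup ((cmDatum L 1 (Matrix.of fun i j : Fin 1 => if i.val + j.val + 1 = 1 then (1 : L) else 0)).Local v)) :
                Set ((cmDatum L 1 (Matrix.of fun i j : Fin 1 => if i.val + j.val + 1 = 1 then (1 : L) else 0)).Local v))),
              (∃ σ : IrrClass ((cmDatum L 2 (Matrix.of fun i j : Fin 2 => if i.val + j.val + 1 = 2 then (1 : L) else 0)).Local v),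
                  σ.IsAdmissible ∧
                    ∀ c : IrrClass ((cmDatum L 2 (Matrix.of fun i j : Fin 2 => if i.val + j.val + 1 = 2 then (1 : L) else 0)).Local v),
                      c ∈ O ↔
                        ∃ (T : GL (Fin 2) (LocalRing L v)) (a : LocalRing L v) (ha : IsUnit a)
                          (h : formCongr (conjLocal L (IsCMField.complexConj L) v) T
                              ((Matrix.of fun i j : Fin 2 => if i.val + j.val + 1 = 2 then (1 : L) else 0).map (algebraMap L (LocalRing L v))) =
                            a • (Matrix.of fun i j : Fin 2 => if i.val + j.val + 1 = 2 then (1 : L) else 0).map (algebraMap L (LocalRing L v))),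
                          c = IrrClass.comap (cmDatumLocalCongr L v T ha h) σ) ∧
                S = O.map ⟨IrrClass.boxChar χ hχ, IrrClass.boxChar_injective χ hχ⟩) ∧
            τ ∈ S := by
  intro L _ _ _ v τ hτ
  -- compact open subgroups of the two factors
  obtain ⟨hK₂c, hK₂o⟩ := isCompact_isOpen_cmLocalIntegralLevel L 2 (Matrix.of fun i j : Fin 2 => if i.val + j.val + 1 = 2 then (1 : L) else 0) v
  obtain ⟨hK₁c, hK₁o⟩ := isCompact_isOpen_cmLocalIntegralLevel L 1 (Matrix.of fun i j : Fin 1 => if i.val + j.val + 1 = 1 then (1 : L) else 0) v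
  -- `U(Φ₁)(L⁺_v) ≤ GL₁(L ⊗ L⁺_v)` is commutative
  have hcomm : ∀ a b : (cmDatum L 1 (Matrix.of fun i j : Fin 1 => if i.val + j.val + 1 = 1 then (1 : L) else 0)).Local v, a * b = b * a := by
    intro a b
    apply Subtype.ext
    apply Units.ext
    refine Matrix.ext fun i j => ?_
    change ((a.1 : Matrix (Fin 1) (Fin 1) (LocalRing L v)) * (b.1 : Matrix (Fin 1) (Fin 1) (LocalRing L v))) i j =
      ((b.1 : Matrix (Fin 1) (Fin 1) (LocalRing L v)) * (a.1 : Matrix (Fin 1) (Fin 1) (LocalRing L v))) i j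
    rw [Matrix.mul_apply, Matrix.mul_apply, Fin.sum_univ_one, Fin.sum_univ_one, Subsingleton.elim i 0, Subsingleton.elim j 0, mul_comm]
  -- (F1) `τ = σ₀ ⊠ χ`
  obtain ⟨σ₀, χ, hχ, hσ₀, rfl⟩ := exists_eq_boxChar_of_isAdmissible hcomm hK₂o hK₂c hK₁o hK₁c hτ
  -- (F2c) the similitude orbit of `σ₀` is a finset
  obtain ⟨O, -, hO⟩ := exists_finset_similOrbit_card_le_two L v σ₀
  -- `σ₀ ∈ O`: `T = 1` is a similitude and `Ad(1)` fixes every class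
  have h1 : formCongr (conjLocal L (IsCMField.complexConj L) v) (1 : GL (Fin 2) (LocalRing L v))
      ((Matrix.of fun i j : Fin 2 => if i.val + j.val + 1 = 2 then (1 : L) else 0).map (algebraMap L (LocalRing L v))) =
      (1 : LocalRing L v) • (Matrix.of fun i j : Fin 2 => if i.val + j.val + 1 = 2 then (1 : L) else 0).map (algebraMap L (LocalRing L v)) := by
    rw [formCongr_one_eq, one_smul]
  have hσ₀O : σ₀ ∈ O := by
    refine (hO σ₀).2 ⟨1, 1, isUnit_one, h1, (IrrClass.comap_eq_self_of_forall_eq_conj _ 1 (fun g => ?_) σ₀).symm⟩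
    apply Subtype.ext
    rw [coe_cmDatumLocalCongr_apply]
    simp
  exact ⟨O.map ⟨IrrClass.boxChar χ hχ, IrrClass.boxChar_injective χ hχ⟩, ⟨O, χ, hχ, ⟨σ₀, hσ₀, hO⟩, rfl⟩,
    Finset.mem_map_of_mem _ hσ₀O⟩

end Summit.HodgeConjecture.HodgeConjecture.R90.S4

end
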